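import Mathlib.Algebra.BigOperators.Ring.Finset
import Mathlib.Algebra.Ring.Int.Defs
import Mathlib.Data.Fintype.Prod
import HarnessLib

/-!
# Venture HSemireg — THEOREM H from THEOREM F's fibre balance plus ONE NET PARTNER PER LAYER

Fourth companion to `FibrePartition.lean` (THEOREM F, k = 161), `WeightedFibreCounterexample.lean`
(PROPOSITION H⁻, k = 228), `AdditiveClassDeath.lean` (THEOREM H, pad-pair form, k = 239) and
`LatinSquareCertificate.lean` (LEMMA H″, k = 241) — cell pub-hsemireg, seat p2 gen 14, note
`p2/wlaws/NET-REDUCTION-p2g14.md`.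

SETTING (there). The Weil triples of a reduced flat-LEGO configuration `Z` are triples
`(ℓ, L, m)` of sloped lines in the three slots; the class of a triple is `s(ℓ) + s(L) + s(m) (mod 3)`;
a weighting `w` is CLASS-DEAD iff the class sums `n_k(w) = ∑_{class = k} w` agree for all `k`.
For a sloped slot-3 line `m`, a NET PARTNER of the `m`-layer is a triple `R_m = (H, H′, m) ∈ Z`
(`H`, `H′` not Weil lines of the layer) such that `H` meets every Weil line `ℓ` of slot 1 over `m`
in an A-foot `p_ℓ` of `m` and `H′` meets every Weil line `L` of slot 2 over `m` in an A′-foot `q_L`;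
by the exact pad-pair pattern (A·A′) the star of `Z` at `p_ℓ × q_L × m` is then
`{(p_ℓ,S,m), (S,q_L,m), (ℓ,L,m), R_m}`, and ADDITIVITY of `w` there reads
`a_m(ℓ) + a′_m(L) = w(ℓ,L,m) + w(R_m)`.  So on a support with a net partner in every layer an additive
weighting restricted to the Weil triples over `m` is a sum `f_m(ℓ) + g_m(L)` of a slot-1 and a slot-2
term.  THEOREM F (three-direction form, `FIBRE-PARTITION-p2g12.md` §9) says that every fibre
`{L : (ℓ,L,m) ∈ Z Weil}` and `{ℓ : (ℓ,L,m) ∈ Z Weil}` is slope-balanced, i.e. contains equally many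
triples of each class.  THIS FILE is the kernel form of the two-line consequence:

  (NET decomposition on every layer) + (fibre balance in the two point slots) ⇒ class-dead,

as abstract finite bookkeeping: `T` a finite set of triples over index types `ι₁, ι₂, ι₃`, an
arbitrary class map `cls` into any type `K`, integer weights.  `net_class_dead`: if
`w t = f t.2.2 t.1 + g t.2.2 t.2.1` on `T` and, for every pair `(ℓ, m)` and every pair `(L, m)`, the
triples of `T` over that pair are equidistributed over the classes, then
`∑_{t ∈ T, cls t = k} w t = ∑_{t ∈ T, cls t = k'} w t` for all `k, k'`.
`net_class_dead_of_pads`: the same from pad weights `a m ℓ`, `a' m L`, partner weights `r m` and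
additivity `a m ℓ + a' m L = w t + r m` on `T`.  Compared with LEMMA H″ no Latin (3 × 3,
one-line-per-slope) pattern is needed — fibre balance replaces it —, and compared with THEOREM H's
pad-pair form no regularity `N_T = N` is needed: one net partner per layer suffices.  Which supports
carry net partners is a statement about the designs (on all four THEOREM-F-clean skeleton supports of
record every axis pair over every Weil slot-3 line is one: note §2), not part of the kernel.

HONEST FRAMING. Finite sums only; no variety, cycle, cohomology class or semiregularity map occurs;
nothing here bears on HC ∕ HC_CM ∕ HC_AV.
-/

namespace Summit.Ventures.HSemireg
namespace AdditiveNetClassDeath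

open Finset

variable {ι₁ ι₂ ι₃ K : Type*} [Fintype ι₁] [Fintype ι₂] [Fintype ι₃]
  [DecidableEq ι₁] [DecidableEq ι₂] [DecidableEq ι₃] [DecidableEq K]

/-- Summing a function of `π t` over a finite set, regrouped by the value of `π`
(double counting): `∑_{t ∈ S} F (π t) = ∑_x #{t ∈ S | π t = x} · F x`. -/
theorem sum_comp_eq_sum_card_mul {α X : Type*} [Fintype X] [DecidableEq X] (S : Finset α)
    (π : α → X) (F : X → ℤ) :
    ∑ t ∈ S, F (π t) = ∑ x, ((S.filter fun t => π t = x).card : ℤ) * F x := by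
  rw [← sum_fiberwise_of_maps_to (s := S) (t := (univ : Finset X)) (g := π)
    (fun t _ => mem_univ (π t))]
  refine sum_congr rfl fun x _ => ?_
  have : ∑ t ∈ S.filter (fun t => π t = x), F (π t) = ∑ t ∈ S.filter (fun t => π t = x), F x := by
    refine sum_congr rfl fun t ht => ?_
    rw [(mem_filter.1 ht).2]
  rw [this, sum_const, nsmul_eq_mul]

/-- **THEOREM H from fibre balance + net decomposition (kernel).** Let `T` be a finite set of
triples, `cls` any class map, `w` integer weights.  If on `T` the weight splits as a slot-1 term plus
a slot-2 term layer by layer, `w t = f t.2.2 t.1 + g t.2.2 t.2.1` (the NET decomposition), and the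
triples of `T` over every pair `(ℓ, m)` (slot-2 fibres) and over every pair `(L, m)` (slot-1 fibres)
are equidistributed over the classes, then all class sums of `w` on `T` agree. -/
theorem net_class_dead (T : Finset (ι₁ × ι₂ × ι₃)) (cls : ι₁ × ι₂ × ι₃ → K) (w : ι₁ × ι₂ × ι₃ → ℤ)
    (f : ι₃ → ι₁ → ℤ) (g : ι₃ → ι₂ → ℤ)
    (hnet : ∀ t ∈ T, w t = f t.2.2 t.1 + g t.2.2 t.2.1)
    (hbal₂ : ∀ (x : ι₁ × ι₃) (k k' : K),
      ((T.filter fun t => cls t = k).filter fun t => (t.1, t.2.2) = x).card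
        = ((T.filter fun t => cls t = k').filter fun t => (t.1, t.2.2) = x).card)
    (hbal₁ : ∀ (y : ι₂ × ι₃) (k k' : K),
      ((T.filter fun t => cls t = k).filter fun t => (t.2.1, t.2.2) = y).card
        = ((T.filter fun t => cls t = k').filter fun t => (t.2.1, t.2.2) = y).card)
    (k k' : K) :
    ∑ t ∈ T.filter (fun t => cls t = k), w t = ∑ t ∈ T.filter (fun t => cls t = k'), w t := by
  -- class sum = (slot-1 part regrouped over pairs (ℓ, m)) + (slot-2 part regrouped over pairs (L, m))
  have key : ∀ k : K, ∑ t ∈ T.filter (fun t => cls t = k), w t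
      = ∑ x : ι₁ × ι₃, (((T.filter fun t => cls t = k).filter fun t => (t.1, t.2.2) = x).card : ℤ)
            * f x.2 x.1
        + ∑ y : ι₂ × ι₃, (((T.filter fun t => cls t = k).filter fun t => (t.2.1, t.2.2) = y).card : ℤ)
            * g y.2 y.1 := by
    intro k
    have h1 : ∑ t ∈ T.filter (fun t => cls t = k), w t
        = ∑ t ∈ T.filter (fun t => cls t = k), f t.2.2 t.1
          + ∑ t ∈ T.filter (fun t => cls t = k), g t.2.2 t.2.1 := by
      rw [← sum_add_distrib]
      refine sum_congr rfl fun t ht => ?_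
      exact hnet t (mem_filter.1 ht).1
    have h2 := sum_comp_eq_sum_card_mul (T.filter fun t => cls t = k) (fun t => (t.1, t.2.2))
      (fun x : ι₁ × ι₃ => f x.2 x.1)
    have h3 := sum_comp_eq_sum_card_mul (T.filter fun t => cls t = k) (fun t => (t.2.1, t.2.2))
      (fun y : ι₂ × ι₃ => g y.2 y.1)
    rw [h1, h2, h3]
  rw [key k, key k']
  congr 1
  · exact sum_congr rfl fun x _ => by rw [hbal₂ x k k']
  · exact sum_congr rfl fun y _ => by rw [hbal₁ y k k']

/-- **THEOREM H from fibre balance + one net partner per layer (kernel), pad form.** With A-pad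
weights `a m ℓ` at the feet on the net partner's first line, A′-pad weights `a' m L` at the feet on
its second line, the partner's weight `r m`, and ADDITIVITY `a m ℓ + a' m L = w (ℓ, L, m) + r m` at
the nine (or more) exact pad-pair curves of every layer: fibre balance in the two point slots ⇒ all
class sums of `w` agree. -/
theorem net_class_dead_of_pads (T : Finset (ι₁ × ι₂ × ι₃)) (cls : ι₁ × ι₂ × ι₃ → K)
    (w : ι₁ × ι₂ × ι₃ → ℤ) (a : ι₃ → ι₁ → ℤ) (a' : ι₃ → ι₂ → ℤ) (r : ι₃ → ℤ)
    (hadd : ∀ t ∈ T, a t.2.2 t.1 + a' t.2.2 t.2.1 = w t + r t.2.2)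
    (hbal₂ : ∀ (x : ι₁ × ι₃) (k k' : K),
      ((T.filter fun t => cls t = k).filter fun t => (t.1, t.2.2) = x).card
        = ((T.filter fun t => cls t = k').filter fun t => (t.1, t.2.2) = x).card)
    (hbal₁ : ∀ (y : ι₂ × ι₃) (k k' : K),
      ((T.filter fun t => cls t = k).filter fun t => (t.2.1, t.2.2) = y).card
        = ((T.filter fun t => cls t = k').filter fun t => (t.2.1, t.2.2) = y).card)
    (k k' : K) :
    ∑ t ∈ T.filter (fun t => cls t = k), w t = ∑ t ∈ T.filter (fun t => cls t = k'), w t :=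
  net_class_dead T cls w (fun m ℓ => a m ℓ - r m) (fun m L => a' m L)
    (fun t ht => by have := hadd t ht; omega) hbal₂ hbal₁ k k'

end AdditiveNetClassDeath
end Summit.Ventures.HSemireg
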